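import Mathlib.RingTheory.MvPolynomial.Ideal
import Mathlib.Algebra.MvPolynomial.CommRing
import Mathlib.RingTheory.Ideal.Maps
import HarnessLib

/-!
# Ideals generated by variables in polynomial rings: `(xᵢ : i ∈ s)` is the kernel of `xᵢ ↦ 0`

For a commutative ring `R`, an index type `σ` and a set `s ⊆ σ` of variables of
`R[xᵢ : i ∈ σ]`:

* `aeval_ite_eq_zero_iff` — a polynomial is killed by the substitution `xᵢ ↦ 0` (`i ∈ s`),
  `xᵢ ↦ xᵢ` (`i ∉ s`) iff every monomial in its support involves a variable of `s`;
* `ker_aeval_ite_eq_span` — **the kernel of that substitution is the ideal `(xᵢ : i ∈ s)`**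
  (Mathlib's `MvPolynomial.mem_ideal_span_X_image` describes the ideal monomial-wise);
* `isPrime_span_X_image` — hence **`(xᵢ : i ∈ s)` is prime when `R` is a domain** (a kernel onto
  the domain `R[x]`);
* `X_mem_span_X_image_iff`, `span_X_image_le_iff` — `xᵢ ∈ (xⱼ : j ∈ s) ↔ i ∈ s`, and the
  resulting order embedding `s ↦ (xᵢ : i ∈ s)`.

Standard commutative algebra (Hartshorne, *Algebraic Geometry*, I Ex. 2.11 uses these ideals for
the linear subvarieties of `ℙⁿ`); Mathlib (pin v4.32.0) has
`MvPolynomial.mem_ideal_span_X_image` but not the kernel description nor the primality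
(searched: `span_X`, `isPrime_span`, `ker_aeval`). Used by
`Literature/AlgebraicGeometry/Motives/ProjectiveSpaceLinearSubspaces` (coordinate linear subspaces
of `ℙᴺ`). Everything is proved; no named facts.
-/

noncomputable section

open MvPolynomial

namespace Literature.RingTheory.MvPolynomial

section VariableIdeals

variable {R : Type*} [CommRing R] {σ : Type*}

/-- Killing the variables in `s` (`xᵢ ↦ 0` for `i ∈ s`, `xᵢ ↦ xᵢ` otherwise) kills a monomial
involving a variable of `s`. [folklore] -/
theorem aeval_ite_monomial_eq_zero (s : Set σ) [DecidablePred (· ∈ s)] {m : σ →₀ ℕ}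
    (h : ∃ i ∈ s, m i ≠ 0) (c : R) :
    aeval (fun i ↦ if i ∈ s then (0 : MvPolynomial σ R) else X i) (monomial m c) = 0 := by
  obtain ⟨i, hi, hmi⟩ := h
  rw [aeval_monomial, Finsupp.prod,
    Finset.prod_eq_zero (i := i) (Finsupp.mem_support_iff.mpr hmi), mul_zero]
  rw [if_pos hi, zero_pow hmi]

/-- Killing the variables in `s` fixes a monomial involving no variable of `s`. [folklore] -/
theorem aeval_ite_monomial_of_forall (s : Set σ) [DecidablePred (· ∈ s)] {m : σ →₀ ℕ}
    (h : ∀ i ∈ s, m i = 0) (c : R) :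
    aeval (fun i ↦ if i ∈ s then (0 : MvPolynomial σ R) else X i) (monomial m c) =
      monomial m c := by
  rw [aeval_monomial, monomial_eq, Finsupp.prod, Finsupp.prod, MvPolynomial.algebraMap_eq]
  congr 1
  refine Finset.prod_congr rfl fun i hi ↦ ?_
  rw [if_neg fun his ↦ (Finsupp.mem_support_iff.mp hi) (h i his)]

/-- A polynomial is killed by `xᵢ ↦ 0` (`i ∈ s`) iff each of its monomials involves a variable
of `s`. [folklore] -/
theorem aeval_ite_eq_zero_iff (s : Set σ) [DecidablePred (· ∈ s)] (f : MvPolynomial σ R) :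
    aeval (fun i ↦ if i ∈ s then (0 : MvPolynomial σ R) else X i) f = 0 ↔
      ∀ m ∈ f.support, ∃ i ∈ s, m i ≠ 0 := by
  classical
  set φ := aeval (R := R) (fun i ↦ if i ∈ s then (0 : MvPolynomial σ R) else X i) with hφ
  have key : φ f = ∑ m ∈ f.support with ¬ ∃ i ∈ s, m i ≠ 0, monomial m (coeff m f) := by
    conv_lhs => rw [f.as_sum, map_sum]
    rw [Finset.sum_filter]
    refine Finset.sum_congr rfl fun m _ ↦ ?_
    split_ifs with h
    · rw [hφ, aeval_ite_monomial_eq_zero s h]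
    · rw [hφ, aeval_ite_monomial_of_forall s (by push Not at h; exact h)]
  constructor
  · intro h m hm
    by_contra hne
    have hc : coeff m (φ f) = coeff m f := by
      rw [key, coeff_sum, Finset.sum_eq_single m]
      · rw [coeff_monomial, if_pos rfl]
      · intro m' _ hne'
        rw [coeff_monomial, if_neg hne']
      · intro hnot
        exact absurd (Finset.mem_filter.mpr ⟨hm, hne⟩) hnot
    rw [h, coeff_zero] at hc
    exact (mem_support_iff.mp hm) hc.symm
  · intro h
    rw [key]
    refine Finset.sum_eq_zero fun m hm ↦ ?_
    obtain ⟨hm, hnot⟩ := Finset.mem_filter.mp hm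
    exact absurd (h m hm) hnot

/-- **The kernel of killing the variables in `s` is the ideal `(xᵢ : i ∈ s)`** (Mathlib's
`MvPolynomial.mem_ideal_span_X_image` describes that ideal monomial-wise). [folklore] -/
theorem ker_aeval_ite_eq_span (s : Set σ) [DecidablePred (· ∈ s)] :
    RingHom.ker (aeval (fun i ↦ if i ∈ s then (0 : MvPolynomial σ R) else X i)) =
      Ideal.span (X '' s : Set (MvPolynomial σ R)) := by
  ext f
  rw [RingHom.mem_ker, mem_ideal_span_X_image]
  exact aeval_ite_eq_zero_iff s f

/-- **The ideal `(xᵢ : i ∈ s)` of a polynomial ring over a domain is prime** (it is the kernel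
of `xᵢ ↦ 0`, `i ∈ s`, onto a domain). [folklore] -/
theorem isPrime_span_X_image [IsDomain R] (s : Set σ) :
    (Ideal.span (X '' s : Set (MvPolynomial σ R))).IsPrime := by
  classical
  rw [← ker_aeval_ite_eq_span s]
  exact RingHom.ker_isPrime _

/-- `xᵢ ∈ (xⱼ : j ∈ s) ↔ i ∈ s`. [folklore] -/
theorem X_mem_span_X_image_iff [Nontrivial R] {s : Set σ} {i : σ} :
    (X i : MvPolynomial σ R) ∈ Ideal.span (X '' s : Set (MvPolynomial σ R)) ↔ i ∈ s := by
  rw [mem_ideal_span_X_image, support_X]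
  simp only [Finset.mem_singleton, forall_eq, ne_eq]
  constructor
  · rintro ⟨j, hj, hne⟩
    by_cases hji : j = i
    · exact hji ▸ hj
    · exact absurd (Finsupp.single_eq_of_ne hji) hne
  · exact fun hi ↦ ⟨i, hi, by simp⟩

/-- `(xᵢ : i ∈ s) ≤ (xᵢ : i ∈ s') ↔ s ⊆ s'`. [folklore] -/
theorem span_X_image_le_iff [Nontrivial R] {s s' : Set σ} :
    Ideal.span (X '' s : Set (MvPolynomial σ R)) ≤ Ideal.span (X '' s') ↔ s ⊆ s' := by
  constructor
  · intro h i hi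
    exact X_mem_span_X_image_iff.mp (h (X_mem_span_X_image_iff.mpr hi))
  · exact fun h ↦ Ideal.span_mono (Set.image_mono h)

end VariableIdeals

end Literature.RingTheory.MvPolynomial

end
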